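import Mathlib
import Summits.PneNP.PneNP.Theses.OneSlice
import Summits.PneNP.PneNP.Theorems.OneSliceSliceTargetSplit

/-!
# Route OneSlice, crux `MonotoneContinuation` (stmt-PneNP-18471), line `Sketch_ideator1_r1` (ProfileLine) — stub samplerExpansion

The two fixed-rate samplers of the line expand over the Hamming levels of the sampled point (pure double
counting, valid for every real-valued `g` in place of `𝟙[f]` and every real rate). DELETION: for `ρ ∼ G(n,p)`
the point `y ∧ ρ` depends on `ρ` only through `ρ ∩ supp y`; grouping the sum over `ρ` by `x := y ∧ ρ ⊆ y`
(`Finset.sum_fiberwise_of_maps_to`), the fibre `{ρ : y ∧ ρ = x} = {ρ : ρ = x on supp y}` has `G(n,p)`-mass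
`p^{|x|} (1-p)^{|y|-|x|}` (product structure of the weight, `sum_boolVec_prod`: the coordinates off `supp y`
integrate to `1`), while the `x ⊆ y` of weight `r ≤ |y|` are exactly `nbhd r y`, `C(|y|,r)` of them
(`card_nbhd_of_le`), so that `C(|y|,r) · transport r g y = Σ_{x ∈ nbhd r y} g x`; both sides therefore equal
`Σ_{x ⊆ y} p^{|x|} (1-p)^{|y|-|x|} g x`. PADDING: symmetrically, grouping by `x := y ∨ ρ ⊇ y`, the fibre
`{ρ : ρ = x off supp y}` has mass `p^{|x|-|y|} (1-p)^{N-|x|}` and the `x ⊇ y` of weight `|y| + r` form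
`nbhd (|y|+r) y`, `C(N-|y|, r)` of them (`card_nbhd_of_ge`), `N = C(n,2)`.
-/

set_option linter.dupNamespace false -- `Summit.PneNP.PneNP.…`: summit = sub-problem (D-0017)

namespace Summit.PneNP.PneNP.Theorems.MonotoneContinuation

open Literature.Computability.Complexity hiding supp mem_supp
open Finset hiding slice
open Filter hiding mem_sdiff
open Classical
open Summit.PneNP.PneNP.Theorems (binomialWeight_tail_le binomialWeight_sum_range binomialWeight_nonneg
  binomialWeight_variance card_slice)
open Summit.PneNP.PneNP.Theorems.ConstantBand.Negative (Edge thr Central slice)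
open Summit.PneNP.PneNP.Theorems.SingleThreshold.Negative (pc)
open Summit.PneNP.PneNP.Theorems.SliceACZero.Negative (supp mem_supp card_supp supp_injective supp_indicator)
open Summit.PneNP.PneNP.Theorems.SliceTargetSplit (Comp nbhd mem_nbhd transport ind l1 nbhdCard card_nbhd
  card_nbhd_of_le card_nbhd_of_ge choose_mul_nbhdCard nbhdCard_pos sum_slice_sum_nbhd sum_slice_sum_nbhd_left
  supp_subset_of_comp_of_le comp_iff_supp comp_comm ofSet supp_ofSet ofSet_supp edgeCount_ofSet ind_nonneg
  ind_le_one abs_ind_sub_ind l1_triangle l1_comm l1_nonneg transport_nonneg transport_sub)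

noncomputable section

variable {n : ℕ}

/-! ### Fibre masses of the product weight -/

/-- **Cylinder masses of `G(n,p)`.** The `G(n,p)`-mass of the edge vectors agreeing with a fixed vector `x` on
a fixed edge set `S` is `∏_{e ∈ S} (p if x e else 1 - p)` (the coordinates off `S` integrate to `1`; a
polynomial identity, valid for every real `p`). [folklore] -/
theorem samplerExpansion_sum_gnpWeight_filter_agree (p : ℝ) (S : Finset (Edge n)) (x : Edge n → Bool) :
    ∑ ρ ∈ univ.filter (fun ρ : Edge n → Bool => ∀ e ∈ S, ρ e = x e), gnpWeight n p ρ =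
      ∏ e ∈ S, (if x e = true then p else 1 - p) := by
  rw [sum_filter]
  have key : ∀ ρ : Edge n → Bool,
      (if ∀ e ∈ S, ρ e = x e then gnpWeight n p ρ else 0) =
        ∏ e, ((if ρ e = true then p else 1 - p) *
          (if e ∈ S then (if ρ e = x e then 1 else 0) else 1)) := by
    intro ρ
    rw [prod_mul_distrib, ← gnpWeight_eq_prod]
    split_ifs with h
    · rw [prod_eq_one, mul_one]
      intro e _
      by_cases he : e ∈ S
      · rw [if_pos he, if_pos (h e he)]
      · rw [if_neg he]
    · push Not at h
      obtain ⟨e, heS, hρe⟩ := h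
      rw [prod_eq_zero (mem_univ e), mul_zero]
      rw [if_pos heS, if_neg hρe]
  simp_rw [key]
  rw [sum_boolVec_prod (fun e b => (if b = true then p else 1 - p) *
    (if e ∈ S then (if b = x e then (1 : ℝ) else 0) else 1))]
  calc _ = ∏ e : Edge n, (if e ∈ S then (if x e = true then p else 1 - p) else (1 : ℝ)) :=
        prod_congr rfl fun e _ => by by_cases he : e ∈ S <;> cases x e <;> simp [he]
    _ = ∏ e ∈ S, (if x e = true then p else 1 - p) := by rw [prod_ite_mem, univ_inter]

/-- **Deletion fibres.** For `x ⊆ y` (as edge sets), the `G(n,p)`-mass of `{ρ : y ∧ ρ = x}` is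
`p^{|x|} (1-p)^{|y|-|x|}`: the fibre prescribes `ρ` on `supp y` only. [folklore] -/
theorem samplerExpansion_fibre_meet (p : ℝ) {x y : Edge n → Bool} (hxy : supp x ⊆ supp y) :
    ∑ ρ ∈ univ.filter (fun ρ : Edge n → Bool => (fun e => y e && ρ e) = x), gnpWeight n p ρ =
      p ^ edgeCount x * (1 - p) ^ (edgeCount y - edgeCount x) := by
  have hfilter : univ.filter (fun ρ : Edge n → Bool => (fun e => y e && ρ e) = x) =
      univ.filter (fun ρ : Edge n → Bool => ∀ e ∈ supp y, ρ e = x e) := by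
    refine filter_congr fun ρ _ => ⟨fun h e he => ?_, fun h => ?_⟩
    · rw [mem_supp] at he
      have := congrFun h e
      simpa [he] using this
    · funext e
      cases hye : y e
      · have hxe : ¬ x e = true := fun hx => by
          have := mem_supp.1 (hxy (mem_supp.2 hx))
          rw [hye] at this
          exact Bool.false_ne_true this
        simpa using hxe
      · simpa using h e (mem_supp.2 hye)
  have hpos : (supp y).filter (fun e => x e = true) = supp x := by
    ext e
    simp only [mem_filter, mem_supp]
    exact ⟨fun h => h.2, fun h => ⟨mem_supp.1 (hxy (mem_supp.2 h)), h⟩⟩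
  have hneg : #((supp y).filter (fun e => ¬ x e = true)) = edgeCount y - edgeCount x := by
    have := card_filter_add_card_filter_not (s := supp y) (fun e => x e = true)
    rw [hpos, card_supp, card_supp] at this
    exact Nat.eq_sub_of_add_eq' this
  rw [hfilter, samplerExpansion_sum_gnpWeight_filter_agree, prod_ite, prod_const, prod_const, hpos, card_supp,
    hneg]

/-- **Padding fibres.** For `y ⊆ x` (as edge sets), the `G(n,p)`-mass of `{ρ : y ∨ ρ = x}` is
`p^{|x|-|y|} (1-p)^{N-|x|}`, `N = C(n,2)`: the fibre prescribes `ρ` off `supp y` only. [folklore] -/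
theorem samplerExpansion_fibre_join (p : ℝ) {x y : Edge n → Bool} (hyx : supp y ⊆ supp x) :
    ∑ ρ ∈ univ.filter (fun ρ : Edge n → Bool => (fun e => y e || ρ e) = x), gnpWeight n p ρ =
      p ^ (edgeCount x - edgeCount y) * (1 - p) ^ (n.choose 2 - edgeCount x) := by
  have hfilter : univ.filter (fun ρ : Edge n → Bool => (fun e => y e || ρ e) = x) =
      univ.filter (fun ρ : Edge n → Bool => ∀ e ∈ (supp y)ᶜ, ρ e = x e) := by
    refine filter_congr fun ρ _ => ⟨fun h e he => ?_, fun h => ?_⟩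
    · rw [mem_compl, mem_supp] at he
      have := congrFun h e
      simpa [he] using this
    · funext e
      cases hye : y e
      · simpa using h e (by rw [mem_compl, mem_supp, hye]; exact Bool.false_ne_true)
      · simpa using (mem_supp.1 (hyx (mem_supp.2 hye))).symm
  have hpos : (supp y)ᶜ.filter (fun e => x e = true) = supp x \ supp y := by
    ext e
    simp only [mem_filter, mem_compl, mem_sdiff, mem_supp]
    exact ⟨fun h => ⟨h.2, h.1⟩, fun h => ⟨h.2, h.1⟩⟩
  have hneg : (supp y)ᶜ.filter (fun e => ¬ x e = true) = (supp x)ᶜ := by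
    ext e
    simp only [mem_filter, mem_compl, mem_supp]
    exact ⟨fun h => h.2, fun h => ⟨fun hy => h (mem_supp.1 (hyx (mem_supp.2 hy))), h⟩⟩
  rw [hfilter, samplerExpansion_sum_gnpWeight_filter_agree, prod_ite, prod_const, prod_const, hpos, hneg,
    card_sdiff_of_subset hyx, card_supp, card_supp, card_compl, card_edgeSet_top_fin, card_supp]

/-! ### The deletion sampler -/

/-- Every edge vector has at most `C(n,2)` edges. [folklore] -/
theorem samplerExpansion_edgeCount_le (x : Edge n → Bool) : edgeCount x ≤ n.choose 2 := by
  rw [edgeCount, ← card_edgeSet_top_fin n, ← card_univ]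
  exact card_filter_le _ _

/-- Deletion, left-hand side: grouping `ρ` by `x := y ∧ ρ ⊆ y`,
`Σ_ρ w_p(ρ) g(y ∧ ρ) = Σ_{x ⊆ y} p^{|x|} (1-p)^{|y|-|x|} g(x)`. [folklore] -/
theorem samplerExpansion_del_lhs (p : ℝ) (g : (Edge n → Bool) → ℝ) (y : Edge n → Bool) :
    ∑ ρ : Edge n → Bool, gnpWeight n p ρ * g (fun e => y e && ρ e) =
      ∑ x ∈ univ.filter (fun x : Edge n → Bool => supp x ⊆ supp y),
        p ^ edgeCount x * (1 - p) ^ (edgeCount y - edgeCount x) * g x := by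
  rw [← sum_fiberwise_of_maps_to (s := univ) (t := univ.filter (fun x : Edge n → Bool => supp x ⊆ supp y))
    (g := fun ρ : Edge n → Bool => fun e => y e && ρ e)]
  · refine sum_congr rfl fun x hx => ?_
    have hxy : supp x ⊆ supp y := (mem_filter.1 hx).2
    calc ∑ ρ ∈ univ with (fun e => y e && ρ e) = x, gnpWeight n p ρ * g (fun e => y e && ρ e)
        = ∑ ρ ∈ univ with (fun e => y e && ρ e) = x, gnpWeight n p ρ * g x := by
          refine sum_congr rfl fun ρ hρ => ?_
          have hρx : (fun e => y e && ρ e) = x := (mem_filter.1 hρ).2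
          rw [show g (fun e => y e && ρ e) = g x from congrArg g hρx]
      _ = p ^ edgeCount x * (1 - p) ^ (edgeCount y - edgeCount x) * g x := by
          rw [← sum_mul, samplerExpansion_fibre_meet p hxy]
  · intro ρ _
    rw [mem_filter]
    refine ⟨mem_univ _, fun e he => ?_⟩
    rw [mem_supp] at he ⊢
    rw [Bool.and_eq_true] at he
    exact he.1

/-- Deletion, right-hand side: level by level, `C(|y|,r) · (T_r g)(y) = Σ_{x ∈ nbhd r y} g x` and the
`x ∈ nbhd r y`, `r ≤ |y|`, are the `x ⊆ y` with `|x| = r`. [folklore] -/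
theorem samplerExpansion_del_rhs (p : ℝ) (g : (Edge n → Bool) → ℝ) (y : Edge n → Bool) :
    ∑ r ∈ range (edgeCount y + 1),
        ((edgeCount y).choose r : ℝ) * p ^ r * (1 - p) ^ (edgeCount y - r) * transport r g y =
      ∑ x ∈ univ.filter (fun x : Edge n → Bool => supp x ⊆ supp y),
        p ^ edgeCount x * (1 - p) ^ (edgeCount y - edgeCount x) * g x := by
  have hfib : ∀ r ∈ range (edgeCount y + 1),
      (univ.filter (fun x : Edge n → Bool => supp x ⊆ supp y)).filter (fun x => edgeCount x = r) = nbhd r y := by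
    intro r hr
    rw [mem_range, Nat.lt_succ_iff] at hr
    ext x
    simp only [mem_filter, mem_univ, true_and, mem_nbhd]
    constructor
    · rintro ⟨hxy, hxr⟩
      exact ⟨hxr, comp_iff_supp.2 (Or.inl hxy)⟩
    · rintro ⟨hxr, hc⟩
      exact ⟨supp_subset_of_comp_of_le hc (by omega), hxr⟩
  calc ∑ r ∈ range (edgeCount y + 1),
        ((edgeCount y).choose r : ℝ) * p ^ r * (1 - p) ^ (edgeCount y - r) * transport r g y
      = ∑ r ∈ range (edgeCount y + 1), ∑ x ∈ nbhd r y,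
          p ^ edgeCount x * (1 - p) ^ (edgeCount y - edgeCount x) * g x := by
        refine sum_congr rfl fun r hr => ?_
        have hr' : r ≤ edgeCount y := Nat.lt_succ_iff.1 (mem_range.1 hr)
        have hC : ((edgeCount y).choose r : ℝ) ≠ 0 := by exact_mod_cast (Nat.choose_pos hr').ne'
        have hcard : (#(nbhd r y) : ℝ) = (edgeCount y).choose r := by rw [card_nbhd_of_le hr']
        rw [transport, hcard]
        calc ((edgeCount y).choose r : ℝ) * p ^ r * (1 - p) ^ (edgeCount y - r) *
              ((∑ x ∈ nbhd r y, g x) / ((edgeCount y).choose r : ℝ))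
            = p ^ r * (1 - p) ^ (edgeCount y - r) * (∑ x ∈ nbhd r y, g x) *
                (((edgeCount y).choose r : ℝ) / ((edgeCount y).choose r : ℝ)) := by ring
          _ = p ^ r * (1 - p) ^ (edgeCount y - r) * ∑ x ∈ nbhd r y, g x := by rw [div_self hC, mul_one]
          _ = ∑ x ∈ nbhd r y, p ^ edgeCount x * (1 - p) ^ (edgeCount y - edgeCount x) * g x := by
              rw [mul_sum]
              refine sum_congr rfl fun x hx => ?_
              rw [(mem_nbhd.1 hx).1]
    _ = ∑ r ∈ range (edgeCount y + 1),
          ∑ x ∈ (univ.filter (fun x : Edge n → Bool => supp x ⊆ supp y)) with edgeCount x = r,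
            p ^ edgeCount x * (1 - p) ^ (edgeCount y - edgeCount x) * g x :=
        sum_congr rfl fun r hr => by rw [hfib r hr]
    _ = _ := by
        refine sum_fiberwise_of_maps_to (fun x hx => ?_) _
        rw [mem_range, Nat.lt_succ_iff, ← card_supp, ← card_supp]
        exact card_le_card (mem_filter.1 hx).2

/-- **Deletion sampler expansion**: `Σ_ρ w_p(ρ) g(y ∧ ρ) = Σ_{r ≤ |y|} C(|y|,r) p^r (1-p)^{|y|-r} (T_r g)(y)`
for every real `p` and real-valued `g`. [folklore] -/
theorem samplerExpansion_del (p : ℝ) (g : (Edge n → Bool) → ℝ) (y : Edge n → Bool) :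
    ∑ ρ : Edge n → Bool, gnpWeight n p ρ * g (fun e => y e && ρ e) =
      ∑ r ∈ range (edgeCount y + 1),
        ((edgeCount y).choose r : ℝ) * p ^ r * (1 - p) ^ (edgeCount y - r) * transport r g y := by
  rw [samplerExpansion_del_lhs, samplerExpansion_del_rhs]

/-! ### The padding sampler -/

/-- Padding, left-hand side: grouping `ρ` by `x := y ∨ ρ ⊇ y`,
`Σ_ρ w_p(ρ) g(y ∨ ρ) = Σ_{x ⊇ y} p^{|x|-|y|} (1-p)^{N-|x|} g(x)`. [folklore] -/
theorem samplerExpansion_pad_lhs (p : ℝ) (g : (Edge n → Bool) → ℝ) (y : Edge n → Bool) :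
    ∑ ρ : Edge n → Bool, gnpWeight n p ρ * g (fun e => y e || ρ e) =
      ∑ x ∈ univ.filter (fun x : Edge n → Bool => supp y ⊆ supp x),
        p ^ (edgeCount x - edgeCount y) * (1 - p) ^ (n.choose 2 - edgeCount x) * g x := by
  rw [← sum_fiberwise_of_maps_to (s := univ) (t := univ.filter (fun x : Edge n → Bool => supp y ⊆ supp x))
    (g := fun ρ : Edge n → Bool => fun e => y e || ρ e)]
  · refine sum_congr rfl fun x hx => ?_
    have hyx : supp y ⊆ supp x := (mem_filter.1 hx).2
    calc ∑ ρ ∈ univ with (fun e => y e || ρ e) = x, gnpWeight n p ρ * g (fun e => y e || ρ e)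
        = ∑ ρ ∈ univ with (fun e => y e || ρ e) = x, gnpWeight n p ρ * g x := by
          refine sum_congr rfl fun ρ hρ => ?_
          have hρx : (fun e => y e || ρ e) = x := (mem_filter.1 hρ).2
          rw [show g (fun e => y e || ρ e) = g x from congrArg g hρx]
      _ = p ^ (edgeCount x - edgeCount y) * (1 - p) ^ (n.choose 2 - edgeCount x) * g x := by
          rw [← sum_mul, samplerExpansion_fibre_join p hyx]
  · intro ρ _
    rw [mem_filter]
    refine ⟨mem_univ _, fun e he => ?_⟩
    rw [mem_supp] at he ⊢
    rw [he, Bool.true_or]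

/-- Padding, right-hand side: level by level, `C(N-|y|,r) · (T_{|y|+r} g)(y) = Σ_{x ∈ nbhd (|y|+r) y} g x` and
the `x ∈ nbhd (|y|+r) y` are the `x ⊇ y` with `|x| - |y| = r`. [folklore] -/
theorem samplerExpansion_pad_rhs (p : ℝ) (g : (Edge n → Bool) → ℝ) (y : Edge n → Bool) :
    ∑ r ∈ range (n.choose 2 - edgeCount y + 1),
        ((n.choose 2 - edgeCount y).choose r : ℝ) * p ^ r * (1 - p) ^ (n.choose 2 - edgeCount y - r) *
          transport (edgeCount y + r) g y =
      ∑ x ∈ univ.filter (fun x : Edge n → Bool => supp y ⊆ supp x),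
        p ^ (edgeCount x - edgeCount y) * (1 - p) ^ (n.choose 2 - edgeCount x) * g x := by
  have hfib : ∀ r ∈ range (n.choose 2 - edgeCount y + 1),
      (univ.filter (fun x : Edge n → Bool => supp y ⊆ supp x)).filter
        (fun x => edgeCount x - edgeCount y = r) = nbhd (edgeCount y + r) y := by
    intro r _
    ext x
    simp only [mem_filter, mem_univ, true_and, mem_nbhd]
    constructor
    · rintro ⟨hyx, hxr⟩
      have hle : edgeCount y ≤ edgeCount x := by
        rw [← card_supp, ← card_supp]; exact card_le_card hyx
      exact ⟨by omega, comp_iff_supp.2 (Or.inr hyx)⟩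
    · rintro ⟨hxr, hc⟩
      exact ⟨supp_subset_of_comp_of_le (comp_comm.1 hc) (by omega), by omega⟩
  calc ∑ r ∈ range (n.choose 2 - edgeCount y + 1),
        ((n.choose 2 - edgeCount y).choose r : ℝ) * p ^ r * (1 - p) ^ (n.choose 2 - edgeCount y - r) *
          transport (edgeCount y + r) g y
      = ∑ r ∈ range (n.choose 2 - edgeCount y + 1), ∑ x ∈ nbhd (edgeCount y + r) y,
          p ^ (edgeCount x - edgeCount y) * (1 - p) ^ (n.choose 2 - edgeCount x) * g x := by
        refine sum_congr rfl fun r hr => ?_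
        have hr' : r ≤ n.choose 2 - edgeCount y := Nat.lt_succ_iff.1 (mem_range.1 hr)
        have hC : ((n.choose 2 - edgeCount y).choose r : ℝ) ≠ 0 := by
          exact_mod_cast (Nat.choose_pos hr').ne'
        have hcard : (#(nbhd (edgeCount y + r) y) : ℝ) = (n.choose 2 - edgeCount y).choose r := by
          rw [card_nbhd_of_ge (Nat.le_add_right _ _), Nat.add_sub_cancel_left]
        rw [transport, hcard]
        calc ((n.choose 2 - edgeCount y).choose r : ℝ) * p ^ r * (1 - p) ^ (n.choose 2 - edgeCount y - r) *
              ((∑ x ∈ nbhd (edgeCount y + r) y, g x) / ((n.choose 2 - edgeCount y).choose r : ℝ))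
            = p ^ r * (1 - p) ^ (n.choose 2 - edgeCount y - r) * (∑ x ∈ nbhd (edgeCount y + r) y, g x) *
                (((n.choose 2 - edgeCount y).choose r : ℝ) / ((n.choose 2 - edgeCount y).choose r : ℝ)) := by
              ring
          _ = p ^ r * (1 - p) ^ (n.choose 2 - edgeCount y - r) * ∑ x ∈ nbhd (edgeCount y + r) y, g x := by
              rw [div_self hC, mul_one]
          _ = ∑ x ∈ nbhd (edgeCount y + r) y,
                p ^ (edgeCount x - edgeCount y) * (1 - p) ^ (n.choose 2 - edgeCount x) * g x := by
              rw [mul_sum]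
              refine sum_congr rfl fun x hx => ?_
              rw [(mem_nbhd.1 hx).1, Nat.add_sub_cancel_left, Nat.sub_add_eq]
    _ = ∑ r ∈ range (n.choose 2 - edgeCount y + 1),
          ∑ x ∈ (univ.filter (fun x : Edge n → Bool => supp y ⊆ supp x)) with edgeCount x - edgeCount y = r,
            p ^ (edgeCount x - edgeCount y) * (1 - p) ^ (n.choose 2 - edgeCount x) * g x :=
        sum_congr rfl fun r hr => by rw [hfib r hr]
    _ = _ := by
        refine sum_fiberwise_of_maps_to (fun x _ => ?_) _
        rw [mem_range, Nat.lt_succ_iff]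
        exact Nat.sub_le_sub_right (samplerExpansion_edgeCount_le x) _

/-- **Padding sampler expansion**:
`Σ_ρ w_p(ρ) g(y ∨ ρ) = Σ_{r ≤ N-|y|} C(N-|y|,r) p^r (1-p)^{N-|y|-r} (T_{|y|+r} g)(y)`, `N = C(n,2)`, for every real
`p` and real-valued `g`. [folklore] -/
theorem samplerExpansion_pad (p : ℝ) (g : (Edge n → Bool) → ℝ) (y : Edge n → Bool) :
    ∑ ρ : Edge n → Bool, gnpWeight n p ρ * g (fun e => y e || ρ e) =
      ∑ r ∈ range (n.choose 2 - edgeCount y + 1),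
        ((n.choose 2 - edgeCount y).choose r : ℝ) * p ^ r * (1 - p) ^ (n.choose 2 - edgeCount y - r) *
          transport (edgeCount y + r) g y := by
  rw [samplerExpansion_pad_lhs, samplerExpansion_pad_rhs]

/-! ### The registered stub -/

/-- **SamplerExpansion** (stub `stub_samplerExpansion` of line `Sketch_ideator1_r1`). The deletion sampler
`y ↦ E_{ρ ∼ G(n,1-q)} 𝟙[f](y ∧ ρ)` is the `Bin(|y|, 1-q)`-mixture of the downward transports of `𝟙[f]` at `y`,
and the padding sampler `y ↦ E_{ρ ∼ G(n,q)} 𝟙[f](y ∨ ρ)` is the `|y| + Bin(C(n,2)-|y|, q)`-mixture of the upward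
transports; `f` arbitrary, `q` any real. [folklore] -/
theorem stub_samplerExpansion :
  (∀ (n : ℕ) (q : ℝ) (f : (Edge n → Bool) → Bool) (y : Edge n → Bool),
    (∑ ρ : Edge n → Bool, gnpWeight n (1 - q) ρ * ind f (fun e => y e && ρ e)) =
      ∑ r ∈ range (edgeCount y + 1),
        ((edgeCount y).choose r : ℝ) * (1 - q) ^ r * (1 - (1 - q)) ^ (edgeCount y - r) * transport r (ind f) y) ∧
  (∀ (n : ℕ) (q : ℝ) (f : (Edge n → Bool) → Bool) (y : Edge n → Bool),
    (∑ ρ : Edge n → Bool, gnpWeight n q ρ * ind f (fun e => y e || ρ e)) =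
      ∑ r ∈ range (n.choose 2 - edgeCount y + 1),
        ((n.choose 2 - edgeCount y).choose r : ℝ) * q ^ r * (1 - q) ^ (n.choose 2 - edgeCount y - r) *
          transport (edgeCount y + r) (ind f) y) :=
  ⟨fun _ q f y => samplerExpansion_del (1 - q) (ind f) y, fun _ q f y => samplerExpansion_pad q (ind f) y⟩

end

end Summit.PneNP.PneNP.Theorems.MonotoneContinuation
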